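import Summits.QuantumFields.YangMills.Theorems.BalabanUVNodesN08AlphaGaussianFluct
import Summits.QuantumFields.YangMills.Theorems.BalabanUVNodesN08AlphaLogZ

/-!
# Route «BalabanUVNodes», Track-A DAG node N08 = [Balaban1985UV3] — THE (α) CLAUSE: the DATA schema `StepDataRows k` ASSEMBLED from its RESIDUAL
# (the class-II rows = the object gap of N08, and the class-III rows not reduced in this lineage) + the two Gaussian pin-shapes of files 3–4 +
# the in-edge b9's faces (covariance and Loewner bounds)

Cell `pub-ymgap`, seat `pub-ymgap-dag-n08-d` gen 3, file 5 (director-ym R134 row «CLASS-I in-edge conclusions at the (α) granularity of `RunAlpha`: type the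
cluster-expansion DATA (41)∕(47) as hypothesis schema and discharge the species-OK interfaces»; census `HOME/pub-ymgap-dag-n08-b/N08-ALPHA-ROWS.md`
6a78a4e68c218d11 §3 «class I conjuncts may be replaced by the in-edge leaves BY NAME, class III conjuncts become theorems, and what REMAINS DISPLAYED is
exactly class II»).  `bears_on: R4∕N08`; filed `--supports stmt-QuantumFields-19903 --as helper`.  THEOREMS ONLY (def-free, sorry-free, standard axioms).

WHAT THIS FILE PROVES.  ★ `stepDataRows_of_residual`: gen 0's 21-row DATA schema `StepDataRows 𝔊 𝔠 X 𝔖 𝔄 k` of one step `k < K` FOLLOWS from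
* THE RESIDUAL, displayed verbatim — CLASS II (the cluster expansion of [B10]∕[8]–[10], census §2 (i)–(vi)): `chart` (G3D-01), `inv26` ((26)),
  `far_le` (G3D-06), `hG` (G3D-02), `h324c` ([B1] (3.24)(c), the FIRST MISSING ESTIMATE), `fibre49` ∕ `fibre57Low` (R3D-01∕02); CLASS III not reduced
  here: `bound28` ((28) on the data's chart configurations), `hVm` ∕ `hVB` (the effective potential `𝒱_k` on the box), `hPm` ∕ `hPb` (the interaction
  sum (43)), and the `rfl`-at-the-pin identifications `hact` ∕ `hPY` ∕ `hPYZ` (R-ACT ∕ batch 11 (a));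
* THE GAUSSIAN IDENTIFICATION OF (58) (file 3 `BalabanUVNodesN08AlphaGaussianFluct`: `μ.map e = N(0, S_k)`, `box h = e⁻¹(ball event of (51))`, count) with the
  in-edge b9's covariance bound `S_{ii} ≤ σ²` and the proviso `4d(𝔤)σ²(6+2κ₀) ≤ b₀⁴` — giving `hμ`, `hboxm`, `hbox`, `h324a`;
* THE GAUSSIAN REPRESENTATION (63) (file 4 `BalabanUVNodesN08AlphaLogZ`): b9's Loewner bounds on `C*Δ_kC = QT` + counts — giving `logZT` (G3D-05) —, and
  the common-core block presentation of `Q1 h`, `QT` + b9's Loewner bounds on the blocks + counts — giving `norm35` (G3D-04).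
So, with gen 0 (`h44`∕`hfloor` from (43)'s form, `hLF67`∕`h68` from the faces), gen 2 (`loop28`), this seat's file 1 (window + constants condition folded),
the (α) clause of record per step is: CLASS II ∧ {`bound28`, `hVm`, `hVB`, `hPm`, `hPb`, `hact`, `hPY`, `hPYZ`} ∧ PIN-SHAPES (Gaussian (58)∕(63)) ∧
IN-EDGE FACES (b9: covariance + Loewner; b11∕b7: `InEdgeFaces₃` at `regMin 𝔠`) ∧ (43)'s form.
HONEST FRAMING: count-neutral kernel bookkeeping; NOT a discharge of N08; every hypothesis is displayed; nothing of [B10] is asserted.  d = 3 lattice gauge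
theory on finite tori as printed; nothing about d = 4, the continuum, OS axioms, a mass gap or the Clay problem.
-/

noncomputable section

namespace Summit.QuantumFields.YangMills.Theorems.BalabanUVNodesN08AlphaResidual

open MeasureTheory ProbabilityTheory Metric
open scoped BigOperators Matrix
open Literature.MathematicalPhysics.QuantumFieldTheory.Balaban1983to89
open Literature.MathematicalPhysics.QuantumFieldTheory.Balaban1983to89.B10
open Literature.MathematicalPhysics.QuantumFieldTheory.Balaban1983to89.B10Eq47Volume (ballEvent)
open Literature.MathematicalPhysics.QuantumFieldTheory.Balaban1983to89.B10Eq24Cumulant (chiMeasure)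
open Literature.MathematicalPhysics.QuantumFieldTheory.Balaban1983to89.TreeLengthTorus (tsys)
open Literature.MathematicalPhysics.QuantumFieldTheory.Balaban1985CMP102
open Literature.MathematicalPhysics.QuantumFieldTheory.Balaban1985CMP102.Setting
open Literature.MathematicalPhysics.QuantumFieldTheory.Balaban1985CMP102.Binders
  (ChartAnalyticityAsCited FarTermsDecayAsCited GraphRep23AsCited)
open Summit.QuantumFields.Balaban3D.Carriers
open Summit.QuantumFields.Balaban3D.Proofs.Inputs
open Summit.QuantumFields.Balaban3D.Proofs.Primitives (AlphaConsts)
open Summit.QuantumFields.Balaban3D.Proofs.GroupModelLieC (lieC)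
open Summit.QuantumFields.Balaban3D.Proofs.UVStability3DInputs
open Summit.QuantumFields.Balaban3D.Proofs.Representation33 (jet26)
open Summit.QuantumFields.Balaban3D.Proofs.Bound55Std (Fibre49 Fibre57Low)
open Summit.QuantumFields.YangMills.Theorems.BalabanUVNodesN08AlphaClassI
open Summit.QuantumFields.YangMills.Theorems.BalabanUVNodesN08AlphaGaussianFluct
open Summit.QuantumFields.YangMills.Theorems.BalabanUVNodesN08AlphaLogZ

variable {L : ℕ}

section Residual

variable {S : Scales L} {G : Type} [GaugeGroup G] [MeasurableSpace G] [HaarData G] (𝔊 : GroupModel G) (𝔠 : AlphaConsts L 𝔊.N)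
  (X : ExternalInputs S G) (𝔖 : ∀ k, StepSeries S G ↥(lieC 𝔊) (nblkOf S 𝔠.lane.carrier k) k) (𝔄 : AlphaData 𝔊 𝔠 X 𝔖) (k : ℕ)

open Classical in
/-- **THE DATA SCHEMA OF ONE STEP FROM ITS RESIDUAL + THE GAUSSIAN PIN-SHAPES + THE IN-EDGE b9's FACES.**  Hypotheses in four groups (all displayed):
(II) the class-II rows verbatim; (III) the class-III rows not reduced in this lineage verbatim; (58) the Gaussian identification of the fluctuation
measure and the box with b9's covariance bound and the proviso; (63) the Loewner bounds ∕ counts ∕ common-core block presentation with b9's Loewner bounds.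
Conclusion: `StepDataRows 𝔊 𝔠 X 𝔖 𝔄 k`. [cite: Balaban1985UV3, (41) p.266 + (58) p.270 + (61)–(63) pp.271–272 + (35) p.265; Balaban1982Higgs1, (3.24) p.616; Balaban1985BackgroundPropagators, Thm 3.11 pp.416–417] -/
theorem stepDataRows_of_residual (hk : k + 1 ≤ S.K)
    -- (II) THE OBJECT GAP, verbatim
    (chart : ∀ Y, ChartAnalyticityAsCited ((𝔖 k).Ψ Y) 𝔠.ρ
      (𝔠.C25 * S.gk k * Real.exp (-(𝔠.κ * (tsys 3 (nblkOf S 𝔠.lane.carrier k)).dj Y))))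
    (inv26 : ∀ Y (U : G), ∀ b ∈ ball (0 : (𝔖 k).E) 𝔠.ρ, adjAct 𝔊 (P := S.P) k U b ∈ ball (0 : (𝔖 k).E) 𝔠.ρ →
      (𝔖 k).Ψ Y (adjAct 𝔊 (P := S.P) k U b) = (𝔖 k).Ψ Y b)
    (far_le : FarTermsDecayAsCited (𝔖 k).far
      (fun Y => 𝔠.C25 * S.gk k * Real.exp (-(𝔠.κ * (tsys 3 (nblkOf S 𝔠.lane.carrier k)).dj Y)))
      𝔠.Cfar (S.gk k ^ 7 * (rFun 𝔠.r₀ (S.gk k) * pFun 𝔠.b₀ 𝔠.p₀ (S.gk k)) ^ 7))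
    (hG : ∀ h, GraphRep23AsCited ((𝔖 k).Gt h) (fun U => ∑ n ∈ Finset.Icc 1 𝔠.nbar, (𝔖 k).cum h U n / (n.factorial : ℝ))
      (𝔄.C₂₃ k) (𝔄.c₂₃ k) (𝔄.M₂₃ k) (𝔄.δ₀ k))
    (h324c : ∀ h U, ∀ t ∈ Set.Icc (0 : ℝ) 1, |iteratedDeriv (𝔠.nbar + 1) (ProbabilityTheory.cgf ((𝔖 k).𝒱 h U)
      (chiMeasure (𝔖 k).μ (((𝔖 k).box h).indicator fun _ => (1 : ℝ)))) t| ≤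
        𝔠.Cc * ((𝔠.nbar + 1).factorial : ℝ) * ((L : ℝ) ^ k * S.g0sq) ^ (3 + 𝔠.κ₀) * S.sites k)
    (fibre49 : ∀ h' : Hist S.P (k + 1), Fibre49 X 𝔠.lane.carrier 𝔖 (fun _ => True) k (piecesW 𝔠.lane X 𝔖 k) h')
    (fibre57Low : Fibre57Low X 𝔠.lane.carrier 𝔖 (fun _ => True) k (piecesW 𝔠.lane X 𝔖 k))
    -- (III) NOT REDUCED HERE, verbatim
    (bound28 : ∀ Y h U, ‖(𝔖 k).Bcfg Y h U‖ ≤ 𝔠.cB * (rFun 𝔠.r₀ (S.gk k) * S.gk k * pFun 𝔠.b₀ 𝔠.p₀ (S.gk k)))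
    (hVm : ∀ h U, AEMeasurable ((𝔖 k).𝒱 h U) (𝔖 k).μ)
    (hVB : ∀ h U, ∀ ω ∈ (𝔖 k).box h, |(𝔖 k).𝒱 h U ω| ≤ 𝔄.Bv k)
    (hPm : ∀ h : Hist S.P k, Measurable ((inputOf 𝔠.lane X 𝔖).Pint k h))
    (hPb : ∀ (h : Hist S.P k) (U : GaugeField S.P k G), (inputOf 𝔠.lane X 𝔖).Pint k h U ≤ 𝔄.cP k)
    (hact : ∀ h Y U, ((𝔖 k).Gt h).activities.act Y U = (𝔖 k).act h Y U)
    (hPY : ∀ h U, (𝔖 k).PY h U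
      = ∑ Y ∈ (𝔖 k).loc (ΩblkOf 𝔠.lane.carrier.M₁ (rcolOf S 𝔠.lane.carrier) (nblkOf S 𝔠.lane.carrier k)) (rretOf S 𝔠.lane.carrier k) h,
          ((jet26 ((𝔖 k).Ψ Y) ((𝔖 k).Bcfg Y h U)).re - (𝔖 k).far Y h U))
    (hPYZ : ∀ h U, (𝔖 k).PYZ h U
      = ∑ Y ∈ (𝔖 k).loc (ΩblkOf 𝔠.lane.carrier.M₁ (rcolOf S 𝔠.lane.carrier) (nblkOf S 𝔠.lane.carrier k)) (rretOf S 𝔠.lane.carrier k) h,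
          ((jet26 ((𝔄.Λc k).Ψ Y) ((𝔖 k).Bcfg Y h U)).re - (𝔄.Λc k).far Y h U))
    -- (58) THE GAUSSIAN IDENTIFICATION OF THE FLUCTUATION MEASURE + b9's covariance bound + the proviso
    {n : ℕ} (Sm : Matrix (Fin n) (Fin n) ℝ) (e : (𝔖 k).Fl → EuclideanSpace ℝ (Fin n)) (he : Measurable e)
    (hμe : (𝔖 k).μ.map e = multivariateGaussian 0 Sm)
    (m : Hist S.P (k + 1) → ℕ) (fib : (h : Hist S.P (k + 1)) → Fin (m h) → Finset (Fin n))
    (hboxe : ∀ h, (𝔖 k).box h = e ⁻¹' ballEvent (fib h) (pFun 𝔠.b₀ 𝔠.p₀ (S.gk k) ^ 2))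
    {σ2 : ℝ} (hσ : 0 < σ2) {dG : ℕ} (hdG : 0 < dG) (hprov : 4 * (dG : ℝ) * σ2 * (6 + 2 * 𝔠.κ₀) ≤ 𝔠.b₀ ^ 4)
    (hpsd : Sm.PosSemidef) (hfib : ∀ h b, (fib h b).card ≤ dG) (hcount : 4 * (n : ℝ) ≤ 𝔠.Ca * S.sites k) (hcov : ∀ i, Sm i i ≤ σ2)
    -- (63) THE GAUSSIAN REPRESENTATION: b9's Loewner bounds on `C*Δ_kC` + counts; the common-core block presentation + Loewner bounds + counts
    (hlowT : ((𝔖 k).QT - 𝔠.cT • (1 : Matrix (Fin (𝔖 k).dimT) (Fin (𝔖 k).dimT) ℝ)).PosSemidef)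
    (hupT : (𝔠.aT • (1 : Matrix (Fin (𝔖 k).dimT) (Fin (𝔖 k).dimT) ℝ) - (𝔖 k).QT).PosSemidef)
    (hcountT : ((𝔖 k).dimT : ℝ) ≤ 𝔠.cn * S.sites k) (hjacT : |(𝔖 k).JT| ≤ 𝔠.cJT * S.sites k)
    (r s t : Hist S.P (k + 1) → ℕ)
    (K : (h : Hist S.P (k + 1)) → Matrix (Fin (r h)) (Fin (r h)) ℝ)
    (B₁ : (h : Hist S.P (k + 1)) → Matrix (Fin (r h)) (Fin (s h)) ℝ) (D₁ : (h : Hist S.P (k + 1)) → Matrix (Fin (s h)) (Fin (s h)) ℝ)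
    (B₂ : (h : Hist S.P (k + 1)) → Matrix (Fin (r h)) (Fin (t h)) ℝ) (D₂ : (h : Hist S.P (k + 1)) → Matrix (Fin (t h)) (Fin (t h)) ℝ)
    (e₁ : (h : Hist S.P (k + 1)) → Fin (r h) ⊕ Fin (s h) ≃ Fin ((𝔖 k).dimZ h))
    (e₂ : (h : Hist S.P (k + 1)) → Fin (r h) ⊕ Fin (t h) ≃ Fin (𝔖 k).dimT)
    (hQ1 : ∀ h, (𝔖 k).Q1 h = Matrix.reindex (e₁ h) (e₁ h) (Matrix.fromBlocks (K h) (B₁ h) (B₁ h)ᴴ (D₁ h)))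
    (hQT : ∀ h, (𝔖 k).QT = Matrix.reindex (e₂ h) (e₂ h) (Matrix.fromBlocks (K h) (B₂ h) (B₂ h)ᴴ (D₂ h)))
    (hlow₁ : ∀ h, (Matrix.fromBlocks (K h) (B₁ h) (B₁ h)ᴴ (D₁ h) -
      𝔠.c35 • (1 : Matrix (Fin (r h) ⊕ Fin (s h)) (Fin (r h) ⊕ Fin (s h)) ℝ)).PosSemidef)
    (hup₁ : ∀ h, (𝔠.a35 • (1 : Matrix (Fin (s h)) (Fin (s h)) ℝ) - D₁ h).PosSemidef)
    (hlow₂ : ∀ h, (Matrix.fromBlocks (K h) (B₂ h) (B₂ h)ᴴ (D₂ h) -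
      𝔠.c35 • (1 : Matrix (Fin (r h) ⊕ Fin (t h)) (Fin (r h) ⊕ Fin (t h)) ℝ)).PosSemidef)
    (hup₂ : ∀ h, (𝔠.a35 • (1 : Matrix (Fin (t h)) (Fin (t h)) ℝ) - D₂ h).PosSemidef)
    (hcount35 : ∀ h, ((s h : ℝ) + t h) ≤ 𝔠.cv * (pieces 𝔠.lane X 𝔖 k).Zvol h)
    (hjac35 : ∀ h, |(𝔖 k).J1 h - (𝔖 k).JT| ≤ 𝔠.cJ35 * (pieces 𝔠.lane X 𝔖 k).Zvol h) :
    StepDataRows 𝔊 𝔠 X 𝔖 𝔄 k := by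
  obtain ⟨hμ, hboxm, hbox, h324a⟩ :=
    gaussianRows_of_gaussianFluct 𝔊 𝔠 𝔖 k Sm e he hμe m fib hboxe hk hσ hdG hprov hpsd hfib hcount hcov
  exact
    { hμ := hμ
      hboxm := hboxm
      hbox := hbox
      hVm := hVm
      hVB := hVB
      chart := chart
      bound28 := bound28
      inv26 := inv26
      far_le := far_le
      hPY := hPY
      hPYZ := hPYZ
      norm35 := norm35_of_blocks 𝔊 𝔠 X 𝔖 k r s t K B₁ D₁ B₂ D₂ e₁ e₂ hQ1 hQT hlow₁ hup₁ hlow₂ hup₂ hcount35 hjac35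
      logZT := logZT_of_loewner 𝔊 𝔠 X 𝔖 k hlowT hupT hcountT hjacT
      hact := hact
      hG := hG
      h324a := h324a
      h324c := h324c
      hPm := hPm
      hPb := hPb
      fibre49 := fibre49
      fibre57Low := fibre57Low }

end Residual

end Summit.QuantumFields.YangMills.Theorems.BalabanUVNodesN08AlphaResidual

end
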